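import Literature.RepresentationTheory.FiniteGroups.SymmetricGroupSquareEvaluation
import Literature.Barriers.ValiantsHypothesis.GCTMatrixPoweringProp19
import HarnessLib

/-!
# Chunked kernel evaluation of the class sum `MNEval.skSumT` (det-side numbers `sk(λ, m × d)`)

Cell `pub-gct` (papers/PneNP/gct-obstructions), engine B's method (Murnaghan–Nakayama class sums)
run inside the Lean kernel. Honest framing of that cell: rung-1 multiplicity-obstruction search for
permanent versus determinant at small `(n, m)`; no claim about VP ≠ VNP or P ≠ NP is made here or
there.

The tree's verified evaluator `MNEval.skSumT n Lt M = Σ_{classes ρ of 𝔖_n} skTerm n Lt M ρ`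
(`SymmetricGroupSquareEvaluation.lean`; semantics `2·(md)!·sk(λ, m×d) = skSumT (md) λᵗ (d^m)`,
`DetOrbitSymKroneckerBoundEval.symKroneckerCoeffRect_eq_of_skSumT_eq`) is one `decide` for
`n ≤ 12` or so; at `n = 30` (the `(3,3)` rows of degree `10`: `p(30) = 5604` classes) a single
`decide` is far beyond one check. This file splits the sum into consecutive index ranges of the
class list `cycleTypes n`:

* `skSumRange n Lt M a k` — the sum over classes `a, …, a+k-1` (each range one `decide +kernel`
  in a certificate file);
* `skSumChunks n Lt M a ks` — consecutive ranges of sizes `ks`;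
* `skSumT_eq_skSumChunks` — `skSumT n Lt M = skSumChunks n Lt M 0 ks` whenever `Σ ks ≥ #classes`.

Also (§2) the two list identities every such certificate needs to feed
`symKroneckerCoeffRect_eq_of_skSumT_eq`: the columns `λᵗ` of a partition with explicitly listed
parts (`sortedParts_transpose_eq_of_parts_eq_coe`, a finite `colCount` check) and the parts of the
rectangle `d^m` (`sortedParts_rectangle`).

## References

* P. Bürgisser, J. M. Landsberg, L. Manivel, J. Weyman, *An overview of mathematical issues
  arising in the geometric complexity theory approach to VP ≠ VNP*, SIAM J. Comput. 40 (2011),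
  §5.2 (5.2.5), Prop. 5.2.1. [BLMW2011]
* W. Fulton, J. Harris, *Representation Theory*, GTM 129, §2.1, Exercise 4.51 (the
  symmetric-square character formula). [FultonHarrisGTM129]
* W. Fulton, *Young Tableaux*, LMS Student Texts 35 (1997), §0 (conjugate partition). [FultonYoungTableaux1997]
-/

namespace Summit.PneNP.GCT

open Literature.RepresentationTheory.FiniteGroups.MNEval (skSumT skTerm cycleTypes)
open Literature.Barriers.ValiantsHypothesis (colCount getD_sortedParts_transpose_eq_colCount
  sup_parts_eq_card_transpose)

/-! ## §1 Index-range chunks of the class sum -/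

/-- The partial class sum of `skSumT n Lt M` over the classes with indices `a, …, a + k - 1` in the
tree's class list `cycleTypes n`. [folklore] -/
def skSumRange (n : ℕ) (Lt M : List ℕ) (a k : ℕ) : ℤ :=
  ((((cycleTypes n).drop a).take k).map (skTerm n Lt M)).sum

/-- Consecutive partial sums of sizes `ks`, starting at class index `a`. [folklore] -/
def skSumChunks (n : ℕ) (Lt M : List ℕ) : ℕ → List ℕ → ℤ
  | _, [] => 0
  | a, k :: ks => skSumRange n Lt M a k + skSumChunks n Lt M (a + k) ks

/-- Splitting a range in two. [folklore] -/
theorem skSumRange_add (n : ℕ) (Lt M : List ℕ) (a j k : ℕ) :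
    skSumRange n Lt M a (j + k) = skSumRange n Lt M a j + skSumRange n Lt M (a + j) k := by
  unfold skSumRange
  rw [List.take_add, List.map_append, List.sum_append, List.drop_drop]

/-- Consecutive chunks sum to one range. [folklore] -/
theorem skSumChunks_eq (n : ℕ) (Lt M : List ℕ) :
    ∀ (a : ℕ) (ks : List ℕ), skSumChunks n Lt M a ks = skSumRange n Lt M a ks.sum
  | a, [] => by simp [skSumChunks, skSumRange]
  | a, k :: ks => by
    rw [skSumChunks, skSumChunks_eq n Lt M (a + k) ks, List.sum_cons, skSumRange_add]

/-- **The class sum from its chunks**: if the chunk sizes cover the class list,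
`skSumT n Lt M = skSumChunks n Lt M 0 ks`. [folklore] -/
theorem skSumT_eq_skSumChunks (n : ℕ) (Lt M : List ℕ) (ks : List ℕ)
    (h : (cycleTypes n).length ≤ ks.sum) : skSumT n Lt M = skSumChunks n Lt M 0 ks := by
  rw [skSumChunks_eq, skSumRange, List.drop_zero, List.take_of_length_le h]
  rfl

/-! ## §2 Explicit lists of parts: columns of a listed partition, the rectangle -/

/-- **The columns of a partition with explicitly listed parts**: if `μ.parts = L` and `Lt` has
length `max L` with `Lt_r = #{x ∈ L : x > r}` for `r < max L` (a finite check), then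
`μᵗ.sortedParts = Lt`. [cite: FultonYoungTableaux1997, §0 (conjugate partition)] -/
theorem sortedParts_transpose_eq_of_parts_eq_coe {d : ℕ} (μ : Nat.Partition d) {L Lt : List ℕ}
    (hL : μ.parts = (L : Multiset ℕ))
    (hLt : Lt.length = (L : Multiset ℕ).sup ∧
      ∀ r ∈ List.range (L : Multiset ℕ).sup, Lt.getD r 0 = colCount (L : Multiset ℕ) r) :
    μ.transpose.sortedParts = Lt := by
  obtain ⟨hlen, hrows⟩ := hLt
  refine List.ext_getElem ?_ fun i h1 h2 => ?_
  · rw [Nat.Partition.length_sortedParts, ← sup_parts_eq_card_transpose, hL, hlen]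
  · have hi : i < (L : Multiset ℕ).sup := hlen ▸ h2
    have e1 := getD_sortedParts_transpose_eq_colCount μ i
    rw [List.getD_eq_getElem _ _ h1, hL] at e1
    have e2 := hrows i (List.mem_range.2 hi)
    rw [List.getD_eq_getElem _ _ h2] at e2
    rw [e1, ← e2]

/-- **The parts of the rectangle `d^m`** as the explicit list `[d, …, d]` (`0 < d`). [folklore] -/
theorem sortedParts_rectangle (m d : ℕ) (hd : 0 < d) :
    (Nat.Partition.rectangle m d).sortedParts = List.replicate m d := by
  refine Literature.RepresentationTheory.FiniteGroups.MNEval.sortedParts_eq_of_parts_eq_coe _ ?_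
    (List.pairwise_replicate.2 (Or.inr le_rfl))
  change (Multiset.replicate m d).filter (· ≠ 0) = _
  rw [Multiset.filter_eq_self.2 (fun x hx => ?_)]
  · rfl
  · rw [Multiset.eq_of_mem_replicate hx]
    exact hd.ne'

end Summit.PneNP.GCT
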